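import Literature.Computability.Complexity.MCSPHardnessFromPCP
import Literature.Computability.Complexity.CSPToCMMSAReductionProofs
import HarnessLib

/-!
# P vs NP family: NP-hardness of `MCSP*` — the trust base after the discharge of the Dinur–Safra implementation fact

Bookkeeping file for the named fact `isRandNPHard_MCSPStar` (`MCSPHardness.lean`; Hirahara,
FOCS 2022, Thm. 1.2 = Thm. 8.5 of ECCC TR22-119), continuing `MCSPHardnessFromPCP.lean`. Of the
three named facts listed there, the implementation fact `dinurSafraMap_mem_FP` (polynomial-time
computability of the patched Dinur–Safra instance map on codes) is now a theorem
(`dinurSafraMap_mem_FP_holds`, `CSPToCMMSAReductionProofs.lean`; a second, typed-algebra proof is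
`CSPToCMMSAMachine.lean`). Hence `isRandNPHard_MCSPStar` — and its companions, the randomized
NP-completeness `IsRandComplete NP MCSPStar` and the fact `NP_subset_BPP_of_MCSPStar_mem_BPP` —
follow from exactly **two** named facts, both deep published theorems:

1. `Hirahara2022_lem53_logPow_queried` (`GapCSPQueried.lean`) — the sliding-scale PCP of
   Dinur–Fischer–Kindler–Raz–Safra 2011 / Dinur–Harsha–Kindler 2015 in compact MaxCSP form
   (Hirahara's Lemma 5.3);
2. `Hirahara2022_gapCMMSA_randReducible_MCSPStar` (`MCSPHardnessProofs.lean`) — Lemma 8.3 with the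
   `MCSP*` case of the proof of Thm. 8.5 (secret sharing for monotone formulas, Nisan–Wigderson
   designs, the Impagliazzo–Wigderson derandomized XOR lemma as a locally list-decodable code,
   Uhlig's theorem, Kolmogorov-complexity information extraction).

## References

* S. Hirahara, *NP-hardness of learning programs and partial MCSP*, FOCS 2022; ECCC TR22-119:
  Thm. 1.2, Thm. 5.2 (proof, pp. 16–18), Lemma 5.3, Lemma 8.3, Thm. 8.5 (p. 30).
-/

namespace Literature.Computability.Complexity

/-- **`MCSP*` is NP-hard under randomized polynomial-time reductions, from the two remaining named
facts** (the PCP of Lemma 5.3 in compact MaxCSP form and Lemma 8.3 / Thm. 8.5 for `MCSP*`): Thm. 5.2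
at `Δ(n) = (log n)^{1/2}` is `Hirahara2022_thm52_sqrtLog_of_lem53` with the implementation fact
discharged (`dinurSafraMap_mem_FP_holds`), combined with Lemma 8.3 by `isRandNPHard_MCSPStar_of_CMMSA`.
[cite: Hirahara2022PartialMCSP, proof of Thm. 8.5 (p. 30) with Thm. 5.2 and Lemma 5.3] -/
theorem isRandNPHard_MCSPStar_of_pcp (h53 : Hirahara2022_lem53_logPow_queried)
    (h83 : Hirahara2022_gapCMMSA_randReducible_MCSPStar) : isRandNPHard_MCSPStar :=
  isRandNPHard_MCSPStar_of_lem53 h53 dinurSafraMap_mem_FP_holds h83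

/-- The randomized NP-completeness of `MCSP*` (`IsRandComplete NP MCSPStar`) from the same two
facts (`MCSP* ∈ NP` is the theorem `MetaComplexity.MCSPStar_mem_NP_holds`). [cite: Hirahara2022PartialMCSP, Thm. 8.5 and §1.2 ("MCSP* ∈ NP")] -/
theorem isRandComplete_NP_MCSPStar_of_pcp (h53 : Hirahara2022_lem53_logPow_queried)
    (h83 : Hirahara2022_gapCMMSA_randReducible_MCSPStar) :
    MetaComplexity.IsRandComplete Nondeterministic.NP MetaComplexity.MCSPStar :=
  isRandComplete_NP_MCSPStar_of_isRandNPHard (isRandNPHard_MCSPStar_of_pcp h53 h83)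

/-- **`MCSP* ∈ BPP ⇒ NP ⊆ BPP` from the same two facts.** [cite: Hirahara2022PartialMCSP, Thm. 1.2 (p. 5) with Thm. 5.2, Lemma 5.3 and Thm. 8.5] -/
theorem NP_subset_BPP_of_MCSPStar_mem_BPP_of_pcp (h53 : Hirahara2022_lem53_logPow_queried)
    (h83 : Hirahara2022_gapCMMSA_randReducible_MCSPStar) : NP_subset_BPP_of_MCSPStar_mem_BPP :=
  NP_subset_BPP_of_MCSPStar_mem_BPP_of_lem53 h53 dinurSafraMap_mem_FP_holds h83

end Literature.Computability.Complexity
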